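import Summits.Ventures.CertifiedManyBodySolver.Downfold.EmeryShapeWindowClosure
import Summits.Ventures.CertifiedManyBodySolver.Downfold.EmeryFermiScalePointsNCCOK26VirtualCorners
import HarnessLib

/-!
# THE ONE-BAND FERMI-SURFACE SHAPE `t′/t` OF THE WHOLE TYPED 3BE BOX `emeryBoxNCCOK26Src (EmeryBoxesKSlicesB)` FROM TWO VIRTUAL CORNERS (two-ray rule + window closure, §B.86;
# router/EMERY-SHAPE-CORNERS.tsv)

Venture CertifiedManyBodySolver, cell `pub/hubbard-downfold` (stage S1; INFLATION-RULES-3to1-B §B.86 (i)), seat hubbard-downfold-mod-4 (technique B, g35); namespace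
`Summit.Ventures.CertifiedManyBodySolver.Downfold.Emery`. Everything PROVED (0 sorry). WHAT THIS IS NOT: a statement about Nd₂₋ₓCeₓCuO₄ x = 0.15 (electron-doped; (K) #24 source box) — the typed box is SCREENING-GRADE (its file's
grade line); `U = 0` one-body kinematics of the σ model (object E = the EXACT `t–t′` shape of the σ Fermi surface, `EmeryFermiSurfaceShape`); no interaction, no `t″`.

For EVERY one-body row `(Δ, t_pd, t_pp, t_pp′) ∈ [1, 41/20] × [9/10, 129/100] × [13/25, 18/25] × [1/50, 1/50]` eV and the fillings below, the one-band `t′/t` of the σ-model Fermi surface AT THAT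
ROW'S OWN FERMI ENERGY lies in the window of the table (device: `EmeryShapeTwoRayRule` + `EmeryShapeWindowClosure`, exactly as `EmeryBoxesLa214ShapeCorners`; virtual corners
`V_lo = (1, 0.9, 0.72, 0.02769)`, `V_hi = (2.05, 1.29, 0.52, 0.01444)`, t_pp′ outside the typed range by the factor b₂/b₁ = 1.385 — the explicit 3 → 1 inflation, zero iff the box is pure or of fixed
t_pp′/t_pp ratio; certificates `EmeryFermiScalePointsNCCOK26VirtualCorners`).

| filling | certified window for t′/t over the WHOLE box | V_lo ε_F bracket | V_hi ε_F bracket | lower closure | EMERY-FS-WINDOWS (g19 sub-box device) | object-E row of record [float] |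
|---|---|---|---|---|---|---|
| n_H = 0.85 (ν = 23/40) | **[-0.3334, -0.2045]** | [1.8879, 1.9029] eV | [2.0785, 2.0935] eV | monotone: L = fsRatio(V_lo; e₁) | [-0.3374,-0.1998] | [-0.62,-0.51] |

Sources: three-band model [HybertsenSchluterChristensen1989, Eq. (1)]; [AndersenEtAl1995, §6]; box rows as cited in the typed object's file.
-/

noncomputable section

namespace Summit.Ventures.CertifiedManyBodySolver.Downfold.Emery

open Real Set

/-- **n_H = 0.85 (ν = 23/40): for every row of the box the one-band Fermi-surface `t′/t` (object E, at the row's own Fermi energy) lies in `[-0.3334, -0.2045]`.** Lower closure: monotone; upper: monotone. [folklore] -/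
theorem nCCOK26Box_fsRatio_nH085 {Δ a b c : ℝ} (hΔ : Δ ∈ Icc (1 : ℝ) ((41 : ℝ) / 20)) (ha : a ∈ Icc ((9 : ℝ) / 10) ((129 : ℝ) / 100)) (hb : b ∈ Icc ((13 : ℝ) / 25) ((18 : ℝ) / 25)) (hc : c ∈ Icc ((1 : ℝ) / 50) ((1 : ℝ) / 50)) :
    fsRatio Δ a b c (fermiEnergyOf Δ a b c ((23 : ℝ) / 40)) ∈ Icc ((-1667 : ℝ) / 5000) ((-409 : ℝ) / 2000) := by
  have hV : ((1 : ℝ) / 50) * ((18 : ℝ) / 25) / ((13 : ℝ) / 25) = ((9 : ℝ) / 325) := by norm_num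
  have hW : ((1 : ℝ) / 50) * ((13 : ℝ) / 25) / ((18 : ℝ) / 25) = ((13 : ℝ) / 900) := by norm_num
  have hVlo := (fermiEnergyOf_of_pointBracketCheck virtPt_NCCOK26Vlo_nH085_br (by norm_num) (by norm_num) (by norm_num) (ν := (23/40 : ℝ)) (by push_cast; exact ⟨le_rfl, le_rfl⟩)).2
  have hVhi := (fermiEnergyOf_of_pointBracketCheck virtPt_NCCOK26Vhi_nH085_br (by norm_num) (by norm_num) (by norm_num) (ν := (23/40 : ℝ)) (by push_cast; exact ⟨le_rfl, le_rfl⟩)).2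
  have hAlo := (fermiEnergyOf_of_pointBracketCheck virtPt_NCCOK26Alo_nH085_br (by norm_num) (by norm_num) (by norm_num) (ν := (23/40 : ℝ)) (by push_cast; exact ⟨le_rfl, le_rfl⟩)).2
  have hTop := (fermiEnergyOf_of_pointBracketCheck virtPt_NCCOK26H_nH085_br (by norm_num) (by norm_num) (by norm_num) (ν := (23/40 : ℝ)) (by push_cast; exact ⟨le_rfl, le_rfl⟩)).2
  push_cast at hVlo hVhi hAlo hTop
  norm_num at hVlo hVhi hAlo hTop
  refine fsRatio_fermiEnergyOf_mem_Icc_windowClosure (Δ₁ := (1 : ℝ)) (Δ₂ := ((41 : ℝ) / 20)) (a₁ := ((9 : ℝ) / 10)) (a₂ := ((129 : ℝ) / 100)) (b₁ := ((13 : ℝ) / 25))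
    (b₂ := ((18 : ℝ) / 25)) (c₁ := ((1 : ℝ) / 50)) (c₂ := ((1 : ℝ) / 50)) (e₁ := ((18879 : ℝ) / 10000)) (e₂ := ((153 : ℝ) / 80)) (e₃ := 0) (e₄ := ((4187 : ℝ) / 2000)) (by norm_num) (by norm_num) (by norm_num) (by norm_num)
    (by norm_num) hΔ ha hb hc (by norm_num) (by norm_num) ?_ ?_ ?_ (by norm_num) ?_ ?_ ?_ (by norm_num) ?_
  · -- regime at the box's Fermi-energy high corner: c₂ b₂ ε_F(Δ₁, a₂, b₂, c₁) ≤ a₁² b₁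
    nlinarith [hTop.2]
  · rw [hV]; exact hVlo.1
  · exact hAlo.2
  · intro ε hε
    rw [hV]
    have hmono := (fsRatio_mem_Icc_on_window_of_dopingDisc_nonpos (Δ := (1 : ℝ)) (a := ((9 : ℝ) / 10)) (b := ((18 : ℝ) / 25)) (c := ((9 : ℝ) / 325))
      (p := ((18879 : ℝ) / 10000)) (q := ((153 : ℝ) / 80)) (by norm_num) (by norm_num) (by norm_num) (by norm_num) (by norm_num) (by norm_num) (by norm_num)
      (by norm_num [dopingDisc]) hε).1
    refine le_trans ?_ hmono
    norm_num [fsRatio, fsD, fsN]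
  · exact (fermiEnergyOf_pos (by norm_num) (by norm_num) (by norm_num) (by norm_num) (by norm_num) (by norm_num)).le
  · rw [hW]; exact hVhi.2
  · intro ε hε
    rw [hW]
    have hmono := (fsRatio_mem_Icc_on_window_of_dopingDisc_nonpos (Δ := ((41 : ℝ) / 20)) (a := ((129 : ℝ) / 100)) (b := ((13 : ℝ) / 25)) (c := ((13 : ℝ) / 900))
      (p := 0) (q := ((4187 : ℝ) / 2000)) (by norm_num) (by norm_num) (by norm_num) (by norm_num) (by norm_num) (by norm_num) (by norm_num)
      (by norm_num [dopingDisc]) hε).2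
    refine le_trans hmono ?_
    norm_num [fsRatio, fsD, fsN]

end Summit.Ventures.CertifiedManyBodySolver.Downfold.Emery
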